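import Literature.Barriers.CriticalPhenomena.GridSAWSquaresEnumeration
import Literature.Barriers.CriticalPhenomena.GridSAWTowersPieceFn
import HarnessLib

/-!
# Squares step of Theorem 7 (4) (Liśkiewicz–Ogihara–Toda 2003), machine part: the GENERATORS of
# the code of `E₃ - σ` — the two piece functions as brick assemblies, and the clipped folds

Sibling of `GridSAWSquaresEnumeration.lean` (WHAT the generators emit: the flat pieces
`scaledPieceFlat k Λ D c i` — family A, the unit edges of the scaled paths, mixed radix
`(e, q, t)` — and `squarePieceFlat k β D c i` — family B, the three new edges of each square,
mixed radix `(e, j, m)` — with `framesOf_squaresInstance`: the framed items of the code of the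
edge list of `squaresInstance P D s t` are the family-A concatenation followed by the family-B
concatenation), of `GridSAWSquaresShift.lean` (the instance, the string map `squaresReduce`, the
named machine fact `LOT2003_thm7_anyLength_squares_FP`) and of `GridSAWTowersPieceFn.lean` (the
same programme for the towered `E₂` of version (1), whose generic bricks — `natZF`, the codes
`encPt`/`encPL`/`encDE`, `nthItemFn_encList_map`, the coder `cV`, the size lemmas, `genPoly`,
`genInitF` — are reused here). This file builds HOW the pieces are emitted, in the tree's `FP`
brick algebra, with no machine written:

* the **context** `ctx w Λ k β v = ⟨w, ⟨1^Λ, ⟨1^k, ⟨1^β, ⟨dpEnc v.1, dpEnc v.2⟩⟩⟩⟩⟩`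
  (canonical presentation code, `Λ = maxEdges D`, the factor `k`, the number of squares `β`,
  the translation) and the piece argument `arg … i = ⟨ctx, 1ⁱ⟩`, with the field projections;
* **Stage A**: the indices `(e, q, t)` of family A (radix `Λ k`, `k`) and `(e, j, m)` of family B
  (radix `3β`, `3`) in unary, by `Plumb.divModFn`;
* **Stage B**: the drawn edge `D[e]`, its path `π`, and the point codes `π[q]` by
  `HashBricks.nthItemFn` (`ptCodeF`);
* **Stage C**: the range bits `[e < |D|]`, `[q + 1 < |π|]`;
* **Stage D**: `ptF`, the sign–magnitude code of the translated point
  `k a + c u + ε + v` (`a = π[q]`, `u = π[q+1] - π[q]`, `c` unary, `ε` a pair of small offsets),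
  `ptF_apply`; the zero test `isZeroZF` deciding `sideVec u`;
* **`pieceAFn`** (frame of the `t`-th unit edge of the `q`-th scaled step of `D[e]`) with
  `pieceAFn_argOf : pieceAFn ⟨ctx, 1ⁱ⟩ = scaledPieceFlat k Λ D (cV v) i`, and **`pieceBFn`**
  (frame of the `m`-th new edge of the `j`-th square of `D[e]`: feet `runPt k p u (2j+2)`,
  `runPt k p u (2j+3)`, corners beside them, `getElem?_edges_sqSite`) with
  `pieceBFn_argOf : pieceBFn ⟨ctx, 1ⁱ⟩ = squarePieceFlat k β D (cV v) i` (valid drawings);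
* the trajectory bounds `length_pieceAFn_argOf_le`, `length_pieceBFn_argOf_le` (pieces have at
  most `sqClip · (|ctx| + 1)` symbols), and the generators
  **`genAFn`/`genBFn = sndPow 2 ∘ foldLoop appF (clipF sqClip piece) genPoly ∘ genInitF`**,
  in `FP` (`genAFn_mem_FP`, `genBFn_mem_FP`), with **`genAFn_ctx`**/**`genBFn_ctx`**: on the
  context of a valid presentation they return the two concatenations of
  `framesOf_squaresInstance`.

What remains after this file: the context builder from the canonical code, the unary header
`1^{|E₃|}`, the field `τ - σ`, the branch on validity / `N ≥ 2`, and the comparison with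
`squaresReduce` (`GridSAWSquaresReduceFP.lean`, next to `GridSAWSquaresShiftFP.lean`).

## References

* M. Liśkiewicz, M. Ogihara, S. Toda, *The complexity of counting self-avoiding walks in
  subgraphs of two-dimensional grids and hypercubes*, TCS 304 (2003) 129–156, §4, proof of
  Theorem 7 (`E₃`: "transforming each edge … to the straight line of length `λ`", "attach above
  the line `β` unit-size squares"; "the pair `(R₁, R₃)` witnesses …"), §2.2 (`R₁` polynomial-time).
* S. Arora, B. Barak, *Computational Complexity: A Modern Approach*, CUP 2009, §1.3 (polynomial
  time is closed under composition and bounded loops), §0.1 (codes of pairs and lists).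
-/

noncomputable section

namespace Literature.Barriers.CriticalPhenomena.GridSAW

open _root_.Computability Literature.Computability.Complexity Literature.Computability.Complexity.Brick
  Polynomial

open TowerGen (natZF natZF_ones natZF_mem_FP encPt encPL encDE encInt encPt_eq encPL_eq encDE_eq
  encDG_eq nthItemFn_encList_map cV cV_eq ofSMFn_encInt signMagOfZF_dpEnc' popCountFn_ones
  onesMulFn_ones dropFn_boolPair_ones ltLenF_ones length_le_of_mem_encList length_encPt_le
  size_natAbs_le_length_encPt size_natAbs_le_length_dpEnc length_encPt_le_of_size natAbs_coord_le
  genPoly genPoly_eval genInitF genInitF_mem_FP genInitF_apply)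

namespace SqGen

/-! ### The context record and the argument of the piece functions -/

/-- **The context** handed to every piece: the canonical presentation code
`w = ⟨P, ⟨D, ⟨s, t⟩⟩⟩`, the unary `1^Λ` (`Λ = maxEdges D`), the unary factor `1^k`, the unary
number of squares `1^β`, and the translation vector as two difference pairs. [folklore] -/
def ctx (w : List Bool) (Λ k β : ℕ) (v : GridPoint) : List Bool :=
  boolPair w (boolPair (ones Λ) (boolPair (ones k) (boolPair (ones β) (boolPair (dpEnc v.1) (dpEnc v.2)))))

/-- The argument of the piece at position `i`: `⟨context, 1ⁱ⟩`. [folklore] -/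
def arg (w : List Bool) (Λ k β : ℕ) (v : GridPoint) (i : ℕ) : List Bool := boolPair (ctx w Λ k β v) (ones i)

/-- Field: the presentation code. [folklore] -/
def wF : List Bool → List Bool := nthF 0 ∘ fstF
/-- Field: `1^Λ`. [folklore] -/
def lamF : List Bool → List Bool := nthF 1 ∘ fstF
/-- Field: `1^k`. [folklore] -/
def ukF : List Bool → List Bool := nthF 2 ∘ fstF
/-- Field: `1^β`. [folklore] -/
def ubF : List Bool → List Bool := nthF 3 ∘ fstF
/-- Field: `dpEnc v.1`. [folklore] -/
def v1F : List Bool → List Bool := nthF 4 ∘ fstF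
/-- Field: `dpEnc v.2`. [folklore] -/
def v2F : List Bool → List Bool := sndPow 4 ∘ fstF
/-- Field: `1ⁱ`. [folklore] -/
def idxF : List Bool → List Bool := sndF

section Fields

variable (w : List Bool) (Λ k β : ℕ) (v : GridPoint) (i : ℕ)

/-- Value of `wF` on a piece argument. [folklore] -/
@[simp] theorem wF_arg : wF (arg w Λ k β v i) = w := by simp [wF, arg, ctx]
/-- Value of `lamF` on a piece argument. [folklore] -/
@[simp] theorem lamF_arg : lamF (arg w Λ k β v i) = ones Λ := by simp [lamF, arg, ctx, nthF]
/-- Value of `ukF` on a piece argument. [folklore] -/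
@[simp] theorem ukF_arg : ukF (arg w Λ k β v i) = ones k := by simp [ukF, arg, ctx, nthF]
/-- Value of `ubF` on a piece argument. [folklore] -/
@[simp] theorem ubF_arg : ubF (arg w Λ k β v i) = ones β := by simp [ubF, arg, ctx, nthF]
/-- Value of `v1F` on a piece argument. [folklore] -/
@[simp] theorem v1F_arg : v1F (arg w Λ k β v i) = dpEnc v.1 := by simp [v1F, arg, ctx, nthF]
/-- Value of `v2F` on a piece argument. [folklore] -/
@[simp] theorem v2F_arg : v2F (arg w Λ k β v i) = dpEnc v.2 := by simp [v2F, arg, ctx, sndPow]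
/-- Value of `idxF` on a piece argument. [folklore] -/
@[simp] theorem idxF_arg : idxF (arg w Λ k β v i) = ones i := by simp [idxF, arg]

end Fields

/-- `wF ∈ FP`. [folklore] -/
theorem wF_mem_FP : wF ∈ FP := comp_mem_FP (nthF_mem_FP 0) fstF_mem_FP
/-- `lamF ∈ FP`. [folklore] -/
theorem lamF_mem_FP : lamF ∈ FP := comp_mem_FP (nthF_mem_FP 1) fstF_mem_FP
/-- `ukF ∈ FP`. [folklore] -/
theorem ukF_mem_FP : ukF ∈ FP := comp_mem_FP (nthF_mem_FP 2) fstF_mem_FP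
/-- `ubF ∈ FP`. [folklore] -/
theorem ubF_mem_FP : ubF ∈ FP := comp_mem_FP (nthF_mem_FP 3) fstF_mem_FP
/-- `v1F ∈ FP`. [folklore] -/
theorem v1F_mem_FP : v1F ∈ FP := comp_mem_FP (nthF_mem_FP 4) fstF_mem_FP
/-- `v2F ∈ FP`. [folklore] -/
theorem v2F_mem_FP : v2F ∈ FP := comp_mem_FP (sndPow_mem_FP 4) fstF_mem_FP
/-- `idxF ∈ FP`. [folklore] -/
theorem idxF_mem_FP : idxF ∈ FP := sndF_mem_FP

/-! ### Stage A: the mixed-radix indices in unary -/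

/-- `1³`. [folklore] -/
def u3F : List Bool → List Bool := fun _ => ones 3

/-- Family A: `⟨1ᵉ, 1^{r}⟩ = divmod (i, Λ · k)`. [folklore] -/
def dmA1F : List Bool → List Bool :=
  Plumb.divModFn ∘ fanoutFn (HashBricks.umulFn ∘ fanoutFn lamF ukF) idxF
/-- Family A: `⟨1^q, 1ᵗ⟩ = divmod (r, k)`. [folklore] -/
def dmA2F : List Bool → List Bool := Plumb.divModFn ∘ fanoutFn ukF (sndF ∘ dmA1F)
/-- Family A: `1ᵉ`. [folklore] -/
def aeF : List Bool → List Bool := fstF ∘ dmA1F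
/-- Family A: `1^q`. [folklore] -/
def aqF : List Bool → List Bool := fstF ∘ dmA2F
/-- Family A: `1ᵗ`. [folklore] -/
def atF : List Bool → List Bool := sndF ∘ dmA2F

/-- Family B: `⟨1ᵉ, 1^{r}⟩ = divmod (i, β · 3)`. [folklore] -/
def dmB1F : List Bool → List Bool :=
  Plumb.divModFn ∘ fanoutFn (HashBricks.umulFn ∘ fanoutFn ubF u3F) idxF
/-- Family B: `⟨1ʲ, 1ᵐ⟩ = divmod (r, 3)`. [folklore] -/
def dmB2F : List Bool → List Bool := Plumb.divModFn ∘ fanoutFn u3F (sndF ∘ dmB1F)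
/-- Family B: `1ᵉ`. [folklore] -/
def beF : List Bool → List Bool := fstF ∘ dmB1F
/-- Family B: `1ʲ`. [folklore] -/
def bjF : List Bool → List Bool := fstF ∘ dmB2F
/-- Family B: `1ᵐ`. [folklore] -/
def bmF : List Bool → List Bool := sndF ∘ dmB2F

/-- The radix components of family A. [folklore] -/
def idxAE (Λ k i : ℕ) : ℕ := i / (Λ * k)
/-- (see `idxAE`) [folklore] -/
def idxAQ (Λ k i : ℕ) : ℕ := i % (Λ * k) / k
/-- (see `idxAE`) [folklore] -/
def idxAT (Λ k i : ℕ) : ℕ := i % (Λ * k) % k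
/-- The radix components of family B. [folklore] -/
def idxBE (β i : ℕ) : ℕ := i / (β * 3)
/-- (see `idxBE`) [folklore] -/
def idxBJ (β i : ℕ) : ℕ := i % (β * 3) / 3
/-- (see `idxBE`) [folklore] -/
def idxBM (β i : ℕ) : ℕ := i % (β * 3) % 3

section IdxApply

variable (w : List Bool) (Λ k β : ℕ) (v : GridPoint) (i : ℕ)

/-- Value of `dmA1F`. [folklore] -/
theorem dmA1F_arg : dmA1F (arg w Λ k β v i) = boolPair (ones (i / (Λ * k))) (ones (i % (Λ * k))) := by
  simp only [dmA1F, Function.comp_apply, fanoutFn_apply, lamF_arg, ukF_arg, idxF_arg,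
    HashBricks.umulFn_boolPair, Plumb.divModFn_boolPair]
/-- Value of `dmA2F`. [folklore] -/
theorem dmA2F_arg : dmA2F (arg w Λ k β v i) = boolPair (ones (i % (Λ * k) / k)) (ones (i % (Λ * k) % k)) := by
  simp only [dmA2F, Function.comp_apply, fanoutFn_apply, ukF_arg, dmA1F_arg, sndF_boolPair, Plumb.divModFn_boolPair]
/-- Value of `aeF`. [folklore] -/
@[simp] theorem aeF_arg : aeF (arg w Λ k β v i) = ones (idxAE Λ k i) := by simp [aeF, dmA1F_arg, idxAE]
/-- Value of `aqF`. [folklore] -/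
@[simp] theorem aqF_arg : aqF (arg w Λ k β v i) = ones (idxAQ Λ k i) := by simp [aqF, dmA2F_arg, idxAQ]
/-- Value of `atF`. [folklore] -/
@[simp] theorem atF_arg : atF (arg w Λ k β v i) = ones (idxAT Λ k i) := by simp [atF, dmA2F_arg, idxAT]

/-- Value of `dmB1F`. [folklore] -/
theorem dmB1F_arg : dmB1F (arg w Λ k β v i) = boolPair (ones (i / (β * 3))) (ones (i % (β * 3))) := by
  simp only [dmB1F, u3F, Function.comp_apply, fanoutFn_apply, ubF_arg, idxF_arg,
    HashBricks.umulFn_boolPair, Plumb.divModFn_boolPair]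
/-- Value of `dmB2F`. [folklore] -/
theorem dmB2F_arg : dmB2F (arg w Λ k β v i) = boolPair (ones (i % (β * 3) / 3)) (ones (i % (β * 3) % 3)) := by
  simp only [dmB2F, u3F, Function.comp_apply, fanoutFn_apply, dmB1F_arg, sndF_boolPair, Plumb.divModFn_boolPair]
/-- Value of `beF`. [folklore] -/
@[simp] theorem beF_arg : beF (arg w Λ k β v i) = ones (idxBE β i) := by simp [beF, dmB1F_arg, idxBE]
/-- Value of `bjF`. [folklore] -/
@[simp] theorem bjF_arg : bjF (arg w Λ k β v i) = ones (idxBJ β i) := by simp [bjF, dmB2F_arg, idxBJ]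
/-- Value of `bmF`. [folklore] -/
@[simp] theorem bmF_arg : bmF (arg w Λ k β v i) = ones (idxBM β i) := by simp [bmF, dmB2F_arg, idxBM]

/-- The flat piece of family A through the radix components. [folklore] -/
theorem scaledPieceFlat_eq (D : List DrawnEdge) (c : GridPoint × GridPoint → List Bool) :
    scaledPieceFlat k Λ D c i = scaledPieceAt k D c (idxAE Λ k i) (idxAQ Λ k i) (idxAT Λ k i) := rfl
/-- The flat piece of family B through the radix components. [folklore] -/
theorem squarePieceFlat_eq (D : List DrawnEdge) (c : GridPoint × GridPoint → List Bool) :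
    squarePieceFlat k β D c i = squarePieceAt k D c (idxBE β i) (idxBJ β i) (idxBM β i) := rfl

end IdxApply

/-- `dmA1F ∈ FP`. [folklore] -/
theorem dmA1F_mem_FP : dmA1F ∈ FP :=
  comp_mem_FP Plumb.divModFn_mem_FP (fanoutFn_mem_FP
    (comp_mem_FP HashBricks.umulFn_mem_FP (fanoutFn_mem_FP lamF_mem_FP ukF_mem_FP)) idxF_mem_FP)
/-- `dmA2F ∈ FP`. [folklore] -/
theorem dmA2F_mem_FP : dmA2F ∈ FP :=
  comp_mem_FP Plumb.divModFn_mem_FP (fanoutFn_mem_FP ukF_mem_FP (comp_mem_FP sndF_mem_FP dmA1F_mem_FP))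
/-- `aeF ∈ FP`. [folklore] -/
theorem aeF_mem_FP : aeF ∈ FP := comp_mem_FP fstF_mem_FP dmA1F_mem_FP
/-- `aqF ∈ FP`. [folklore] -/
theorem aqF_mem_FP : aqF ∈ FP := comp_mem_FP fstF_mem_FP dmA2F_mem_FP
/-- `atF ∈ FP`. [folklore] -/
theorem atF_mem_FP : atF ∈ FP := comp_mem_FP sndF_mem_FP dmA2F_mem_FP
/-- `dmB1F ∈ FP`. [folklore] -/
theorem dmB1F_mem_FP : dmB1F ∈ FP :=
  comp_mem_FP Plumb.divModFn_mem_FP (fanoutFn_mem_FP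
    (comp_mem_FP HashBricks.umulFn_mem_FP (fanoutFn_mem_FP ubF_mem_FP (const_mem_FP _))) idxF_mem_FP)
/-- `dmB2F ∈ FP`. [folklore] -/
theorem dmB2F_mem_FP : dmB2F ∈ FP :=
  comp_mem_FP Plumb.divModFn_mem_FP (fanoutFn_mem_FP (const_mem_FP _) (comp_mem_FP sndF_mem_FP dmB1F_mem_FP))
/-- `beF ∈ FP`. [folklore] -/
theorem beF_mem_FP : beF ∈ FP := comp_mem_FP fstF_mem_FP dmB1F_mem_FP
/-- `bjF ∈ FP`. [folklore] -/
theorem bjF_mem_FP : bjF ∈ FP := comp_mem_FP fstF_mem_FP dmB2F_mem_FP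
/-- `bmF ∈ FP`. [folklore] -/
theorem bmF_mem_FP : bmF ∈ FP := comp_mem_FP sndF_mem_FP dmB2F_mem_FP

/-! ### Stage B: fetching the drawn edge `D[e]` and the codes of the points of its path -/

/-- The code of `D` (header and items). [folklore] -/
def cDF : List Bool → List Bool := nthF 1 ∘ wF
/-- `1^{|D|}`. [folklore] -/
def hdrDF : List Bool → List Bool := fstF ∘ cDF
/-- The items of `D`. [folklore] -/
def itemsDF : List Bool → List Bool := sndF ∘ cDF

section Fetch

variable (eF qF : List Bool → List Bool)

/-- The code of the drawn edge `D[e]`, `e` read in unary by `eF`. [folklore] -/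
def dF : List Bool → List Bool := HashBricks.nthItemFn ∘ fanoutFn eF itemsDF
/-- The code of its path `π`. [folklore] -/
def cπF : List Bool → List Bool := sndPow 1 ∘ dF eF
/-- `1^{|π|}`. [folklore] -/
def hdrπF : List Bool → List Bool := fstF ∘ cπF eF
/-- The items of `π`. [folklore] -/
def itemsπF : List Bool → List Bool := sndF ∘ cπF eF
/-- The code of the point `π[q]`, `q` read in unary by `qF`. [folklore] -/
def ptCodeF : List Bool → List Bool := HashBricks.nthItemFn ∘ fanoutFn qF (itemsπF eF)

variable {eF qF}

/-- `cDF ∈ FP`. [folklore] -/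
theorem cDF_mem_FP : cDF ∈ FP := comp_mem_FP (nthF_mem_FP 1) wF_mem_FP
/-- `hdrDF ∈ FP`. [folklore] -/
theorem hdrDF_mem_FP : hdrDF ∈ FP := comp_mem_FP fstF_mem_FP cDF_mem_FP
/-- `itemsDF ∈ FP`. [folklore] -/
theorem itemsDF_mem_FP : itemsDF ∈ FP := comp_mem_FP sndF_mem_FP cDF_mem_FP
/-- `dF ∈ FP`. [folklore] -/
theorem dF_mem_FP (he : eF ∈ FP) : dF eF ∈ FP :=
  comp_mem_FP HashBricks.nthItemFn_mem_FP (fanoutFn_mem_FP he itemsDF_mem_FP)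
/-- `cπF ∈ FP`. [folklore] -/
theorem cπF_mem_FP (he : eF ∈ FP) : cπF eF ∈ FP := comp_mem_FP (sndPow_mem_FP 1) (dF_mem_FP he)
/-- `hdrπF ∈ FP`. [folklore] -/
theorem hdrπF_mem_FP (he : eF ∈ FP) : hdrπF eF ∈ FP := comp_mem_FP fstF_mem_FP (cπF_mem_FP he)
/-- `itemsπF ∈ FP`. [folklore] -/
theorem itemsπF_mem_FP (he : eF ∈ FP) : itemsπF eF ∈ FP := comp_mem_FP sndF_mem_FP (cπF_mem_FP he)
/-- `ptCodeF ∈ FP`. [folklore] -/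
theorem ptCodeF_mem_FP (he : eF ∈ FP) (hq : qF ∈ FP) : ptCodeF eF qF ∈ FP :=
  comp_mem_FP HashBricks.nthItemFn_mem_FP (fanoutFn_mem_FP hq (itemsπF_mem_FP he))

end Fetch

section FetchApply

variable (P : List GridPoint) (D : List DrawnEdge) (s t : ℕ) (Λ k β : ℕ) (v : GridPoint) (i : ℕ)

/-- The argument on a presentation. [folklore] -/
abbrev argOf : List Bool := arg (encodingDrawnGraphInstance.encode (P, D, s, t)) Λ k β v i

/-- Value of `cDF` on the piece argument of a presentation. [folklore] -/
theorem cDF_argOf : cDF (argOf P D s t Λ k β v i) = boolPair (ones D.length) (encList (D.map encDE)) := by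
  rw [cDF, Function.comp_apply, wF_arg, encDG_eq]; simp [nthF]
/-- Value of `hdrDF` on the piece argument of a presentation. [folklore] -/
@[simp] theorem hdrDF_argOf : hdrDF (argOf P D s t Λ k β v i) = ones D.length := by
  rw [hdrDF, Function.comp_apply, cDF_argOf, fstF_boolPair]
/-- Value of `itemsDF` on the piece argument of a presentation. [folklore] -/
theorem itemsDF_argOf : itemsDF (argOf P D s t Λ k β v i) = encList (D.map encDE) := by
  rw [itemsDF, Function.comp_apply, cDF_argOf, sndF_boolPair]

variable {P D s t Λ k β v i} {eF qF : List Bool → List Bool} {e q : ℕ}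

/-- Value of `dF` on the piece argument of a presentation. [folklore] -/
theorem dF_argOf (hE : eF (argOf P D s t Λ k β v i) = ones e) (he : e < D.length) :
    dF eF (argOf P D s t Λ k β v i) = encDE (D[e]) := by
  rw [dF, Function.comp_apply, fanoutFn_apply, hE, itemsDF_argOf, nthItemFn_encList_map _ he]
/-- Value of `cπF` on the piece argument of a presentation. [folklore] -/
theorem cπF_argOf (hE : eF (argOf P D s t Λ k β v i) = ones e) (he : e < D.length) :
    cπF eF (argOf P D s t Λ k β v i) = encPL (D[e]).2.2 := by
  rw [cπF, Function.comp_apply, dF_argOf hE he, encDE_eq]; simp [sndPow]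
/-- Value of `hdrπF` on the piece argument of a presentation. [folklore] -/
theorem hdrπF_argOf (hE : eF (argOf P D s t Λ k β v i) = ones e) (he : e < D.length) :
    hdrπF eF (argOf P D s t Λ k β v i) = ones (D[e]).2.2.length := by
  rw [hdrπF, Function.comp_apply, cπF_argOf hE he, encPL_eq, fstF_boolPair]
/-- Value of `itemsπF` on the piece argument of a presentation. [folklore] -/
theorem itemsπF_argOf (hE : eF (argOf P D s t Λ k β v i) = ones e) (he : e < D.length) :
    itemsπF eF (argOf P D s t Λ k β v i) = encList ((D[e]).2.2.map encPt) := by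
  rw [itemsπF, Function.comp_apply, cπF_argOf hE he, encPL_eq, sndF_boolPair]
/-- **Value of `ptCodeF`**: the code of `π_e[q]`. [folklore] -/
theorem ptCodeF_argOf (hE : eF (argOf P D s t Λ k β v i) = ones e) (he : e < D.length)
    (hQ : qF (argOf P D s t Λ k β v i) = ones q) (hq : q < (D[e]).2.2.length) :
    ptCodeF eF qF (argOf P D s t Λ k β v i) = encPt ((D[e]).2.2[q]) := by
  rw [ptCodeF, Function.comp_apply, fanoutFn_apply, hQ, itemsπF_argOf hE he, nthItemFn_encList_map _ hq]

end FetchApply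

/-! ### Stage C: the range bits -/

/-- Family A: `[e < |D|]`. [folklore] -/
def cA1F : List Bool → List Bool := ltLenF ∘ fanoutFn aeF hdrDF
/-- Family A: `[q + 1 < |π|]`. [folklore] -/
def cA2F : List Bool → List Bool := ltLenF ∘ fanoutFn (List.cons true ∘ aqF) (hdrπF aeF)
/-- Family A: the range condition. [folklore] -/
def rangeAF : List Bool → List Bool := andFn cA1F cA2F
/-- Family B: `[e < |D|]` (the whole range condition: `j < β` and `m < 3` hold by construction).
[folklore] -/
def cB1F : List Bool → List Bool := ltLenF ∘ fanoutFn beF hdrDF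

/-- `cA1F ∈ FP`. [folklore] -/
theorem cA1F_mem_FP : cA1F ∈ FP := comp_mem_FP ltLenF_mem_FP (fanoutFn_mem_FP aeF_mem_FP hdrDF_mem_FP)
/-- `cA2F ∈ FP`. [folklore] -/
theorem cA2F_mem_FP : cA2F ∈ FP :=
  comp_mem_FP ltLenF_mem_FP (fanoutFn_mem_FP (comp_mem_FP (cons_mem_FP true) aqF_mem_FP) (hdrπF_mem_FP aeF_mem_FP))
/-- `rangeAF ∈ FP`. [folklore] -/
theorem rangeAF_mem_FP : rangeAF ∈ FP := andFn_mem_FP cA1F_mem_FP cA2F_mem_FP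
/-- `cB1F ∈ FP`. [folklore] -/
theorem cB1F_mem_FP : cB1F ∈ FP := comp_mem_FP ltLenF_mem_FP (fanoutFn_mem_FP beF_mem_FP hdrDF_mem_FP)

/-- `cA2F` is one-bit. [folklore] -/
theorem oneBit_cA2F : OneBit cA2F := oneBit_ltLenF.comp _
/-- `rangeAF` is one-bit. [folklore] -/
theorem oneBit_rangeAF : OneBit rangeAF := oneBit_andFn (oneBit_ltLenF.comp _) oneBit_cA2F
/-- `cB1F` is one-bit. [folklore] -/
theorem oneBit_cB1F : OneBit cB1F := oneBit_ltLenF.comp _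

section CondApply

variable (P : List GridPoint) (D : List DrawnEdge) (s t : ℕ) (Λ k β : ℕ) (v : GridPoint) (i : ℕ)

/-- Value of `cA1F`. [folklore] -/
theorem cA1F_argOf : cA1F (argOf P D s t Λ k β v i) = [decide (idxAE Λ k i < D.length)] := by
  rw [cA1F, Function.comp_apply, fanoutFn_apply, aeF_arg, hdrDF_argOf, ltLenF_ones]

/-- Value of `cB1F`. [folklore] -/
theorem cB1F_argOf : cB1F (argOf P D s t Λ k β v i) = [decide (idxBE β i < D.length)] := by
  rw [cB1F, Function.comp_apply, fanoutFn_apply, beF_arg, hdrDF_argOf, ltLenF_ones]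

variable {D Λ k i}

/-- Value of `cA2F`, in range. [folklore] -/
theorem cA2F_argOf (he : idxAE Λ k i < D.length) :
    cA2F (argOf P D s t Λ k β v i) = [decide (idxAQ Λ k i + 1 < (D[idxAE Λ k i]).2.2.length)] := by
  rw [cA2F, Function.comp_apply, fanoutFn_apply, Function.comp_apply, aqF_arg, ← Com.ones_succ,
    hdrπF_argOf (aeF_arg _ _ _ _ _ _) he, ltLenF_ones]

/-- **The range condition of family A decides whether the piece is empty**: it holds iff
`e < |D|` and `q + 1 < |π_e|`. [folklore] -/
theorem rangeAF_argOf_eq_true_iff (D : List DrawnEdge) (Λ k i : ℕ) :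
    rangeAF (argOf P D s t Λ k β v i) = [true] ↔
      ∃ he : idxAE Λ k i < D.length, idxAQ Λ k i + 1 < (D[idxAE Λ k i]).2.2.length := by
  by_cases he : idxAE Λ k i < D.length
  · rw [rangeAF, andFn_apply (cA1F_argOf P D s t Λ k β v i) (cA2F_argOf P s t β v he)]
    simp [he]
  · obtain ⟨b₂, hb₂⟩ := oneBit_cA2F (argOf P D s t Λ k β v i)
    rw [rangeAF, andFn_apply (cA1F_argOf P D s t Λ k β v i) hb₂]
    simp [he]

end CondApply

/-! ### Stage D: translated points `k a + c u + ε + v` as sign–magnitude codes -/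

section Coords

variable (paF pbF cF e1F e2F : List Bool → List Bool)

/-- `dpEnc k`. [folklore] -/
def zkF : List Bool → List Bool := natZF ∘ ukF
/-- `dpEnc a.1` (`a` the point coded by `paF`). [folklore] -/
def a1F : List Bool → List Bool := ofSMFn ∘ fstF ∘ paF
/-- `dpEnc a.2`. [folklore] -/
def a2F : List Bool → List Bool := ofSMFn ∘ sndF ∘ paF
/-- `dpEnc u.1` (`u = b - a`, `b` the point coded by `pbF`). [folklore] -/
def u1F : List Bool → List Bool := zsubF ∘ fanoutFn (ofSMFn ∘ fstF ∘ pbF) (a1F paF)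
/-- `dpEnc u.2`. [folklore] -/
def u2F : List Bool → List Bool := zsubF ∘ fanoutFn (ofSMFn ∘ sndF ∘ pbF) (a2F paF)
/-- `dpEnc (k a.1 + c u.1 + ε₁ + v.1)`: first coordinate of the translated point. [folklore] -/
def x1F : List Bool → List Bool :=
  zaddF ∘ fanoutFn (zaddF ∘ fanoutFn (zaddF ∘ fanoutFn (zmulF ∘ fanoutFn zkF (a1F paF))
    (zmulF ∘ fanoutFn (natZF ∘ cF) (u1F paF pbF))) e1F) v1F
/-- `dpEnc (k a.2 + c u.2 + ε₂ + v.2)`: second coordinate. [folklore] -/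
def x2F : List Bool → List Bool :=
  zaddF ∘ fanoutFn (zaddF ∘ fanoutFn (zaddF ∘ fanoutFn (zmulF ∘ fanoutFn zkF (a2F paF))
    (zmulF ∘ fanoutFn (natZF ∘ cF) (u2F paF pbF))) e2F) v2F
/-- **The sign–magnitude code of the translated point `k a + c u + ε + v`.** [folklore] -/
def ptF : List Bool → List Bool :=
  fanoutFn (signMagOfZF ∘ x1F paF pbF cF e1F) (signMagOfZF ∘ x2F paF pbF cF e2F)

variable {paF pbF cF e1F e2F}

/-- `zkF ∈ FP`. [folklore] -/
theorem zkF_mem_FP : zkF ∈ FP := comp_mem_FP natZF_mem_FP ukF_mem_FP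
/-- `a1F ∈ FP`. [folklore] -/
theorem a1F_mem_FP (ha : paF ∈ FP) : a1F paF ∈ FP := comp_mem_FP ofSMFn_mem_FP (comp_mem_FP fstF_mem_FP ha)
/-- `a2F ∈ FP`. [folklore] -/
theorem a2F_mem_FP (ha : paF ∈ FP) : a2F paF ∈ FP := comp_mem_FP ofSMFn_mem_FP (comp_mem_FP sndF_mem_FP ha)
/-- `u1F ∈ FP`. [folklore] -/
theorem u1F_mem_FP (ha : paF ∈ FP) (hb : pbF ∈ FP) : u1F paF pbF ∈ FP :=
  comp_mem_FP zsubF_mem_FP (fanoutFn_mem_FP (comp_mem_FP ofSMFn_mem_FP (comp_mem_FP fstF_mem_FP hb)) (a1F_mem_FP ha))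
/-- `u2F ∈ FP`. [folklore] -/
theorem u2F_mem_FP (ha : paF ∈ FP) (hb : pbF ∈ FP) : u2F paF pbF ∈ FP :=
  comp_mem_FP zsubF_mem_FP (fanoutFn_mem_FP (comp_mem_FP ofSMFn_mem_FP (comp_mem_FP sndF_mem_FP hb)) (a2F_mem_FP ha))
/-- `x1F ∈ FP`. [folklore] -/
theorem x1F_mem_FP (ha : paF ∈ FP) (hb : pbF ∈ FP) (hc : cF ∈ FP) (h1 : e1F ∈ FP) : x1F paF pbF cF e1F ∈ FP :=
  comp_mem_FP zaddF_mem_FP (fanoutFn_mem_FP (comp_mem_FP zaddF_mem_FP (fanoutFn_mem_FP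
    (comp_mem_FP zaddF_mem_FP (fanoutFn_mem_FP (comp_mem_FP zmulF_mem_FP (fanoutFn_mem_FP zkF_mem_FP (a1F_mem_FP ha)))
      (comp_mem_FP zmulF_mem_FP (fanoutFn_mem_FP (comp_mem_FP natZF_mem_FP hc) (u1F_mem_FP ha hb))))) h1)) v1F_mem_FP)
/-- `x2F ∈ FP`. [folklore] -/
theorem x2F_mem_FP (ha : paF ∈ FP) (hb : pbF ∈ FP) (hc : cF ∈ FP) (h2 : e2F ∈ FP) : x2F paF pbF cF e2F ∈ FP :=
  comp_mem_FP zaddF_mem_FP (fanoutFn_mem_FP (comp_mem_FP zaddF_mem_FP (fanoutFn_mem_FP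
    (comp_mem_FP zaddF_mem_FP (fanoutFn_mem_FP (comp_mem_FP zmulF_mem_FP (fanoutFn_mem_FP zkF_mem_FP (a2F_mem_FP ha)))
      (comp_mem_FP zmulF_mem_FP (fanoutFn_mem_FP (comp_mem_FP natZF_mem_FP hc) (u2F_mem_FP ha hb))))) h2)) v2F_mem_FP)
/-- `ptF ∈ FP`. [folklore] -/
theorem ptF_mem_FP (ha : paF ∈ FP) (hb : pbF ∈ FP) (hc : cF ∈ FP) (h1 : e1F ∈ FP) (h2 : e2F ∈ FP) :
    ptF paF pbF cF e1F e2F ∈ FP :=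
  fanoutFn_mem_FP (comp_mem_FP signMagOfZF_mem_FP (x1F_mem_FP ha hb hc h1))
    (comp_mem_FP signMagOfZF_mem_FP (x2F_mem_FP ha hb hc h2))

/-- **The point code computed by `ptF`**, from the values of its argument bricks: the code of
`(k a.1 + c (b - a).1 + ε₁ + v.1, k a.2 + c (b - a).2 + ε₂ + v.2)`. [folklore] -/
theorem ptF_apply {z : List Bool} {a b vv : GridPoint} {kk c : ℕ} {ε₁ ε₂ : ℤ} (hk : ukF z = ones kk)
    (hv1 : v1F z = dpEnc vv.1) (hv2 : v2F z = dpEnc vv.2) (ha : paF z = encPt a) (hb : pbF z = encPt b)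
    (hc : cF z = ones c) (he1 : e1F z = dpEnc ε₁) (he2 : e2F z = dpEnc ε₂) :
    ptF paF pbF cF e1F e2F z =
      encPt ((kk : ℤ) * a.1 + c * (b.1 - a.1) + ε₁ + vv.1, (kk : ℤ) * a.2 + c * (b.2 - a.2) + ε₂ + vv.2) := by
  simp only [ptF, x1F, x2F, a1F, a2F, u1F, u2F, zkF, fanoutFn_apply, Function.comp_apply, hk, hv1, hv2, ha, hb,
    hc, he1, he2, natZF_ones, encPt_eq, fstF_boolPair, sndF_boolPair, ofSMFn_encInt, zmulF_boolPair,
    zaddF_boolPair, zsubF_boolPair, ival_dpEnc, signMagOfZF_dpEnc']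

end Coords

/-! ### Small bricks: the zero test of a difference pair, bits as offsets -/

/-- `[z = 0]` on the canonical difference-pair code of `z` (the sum of the two numerals is
`bin |z|`, empty iff `z = 0`). [folklore] -/
def isZeroZF : List Bool → List Bool := isNilFn ∘ addFn

/-- `isZeroZF ∈ FP`. [folklore] -/
theorem isZeroZF_mem_FP : isZeroZF ∈ FP := comp_mem_FP isNilFn_mem_FP addFn_mem_FP

/-- `isZeroZF` is one-bit. [folklore] -/
theorem oneBit_isZeroZF : OneBit isZeroZF := oneBit_isNilFn.comp _

/-- **Value of the zero test**: `isZeroZF (dpEnc z) = [z = 0]`. [folklore] -/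
theorem isZeroZF_dpEnc (z : ℤ) : isZeroZF (dpEnc z) = [decide (z = 0)] := by
  rw [isZeroZF, Function.comp_apply, dpEnc_eq, addFn_boolPair, bitsToNat_cP_add_cQ]
  simp only [isNilFn, encodeNat_eq_nil_iff, Int.natAbs_eq_zero]

/-- The offset `dpEnc [c]` (`1` if the bit `c` holds, else `0`). [folklore] -/
def bitZF (c : List Bool → List Bool) : List Bool → List Bool :=
  natZF ∘ iteFn c (fun _ => [true]) fun _ => []

/-- `bitZF c ∈ FP`. [folklore] -/
theorem bitZF_mem_FP {c : List Bool → List Bool} (hc : c ∈ FP) : bitZF c ∈ FP :=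
  comp_mem_FP natZF_mem_FP (iteFn_mem_FP hc (const_mem_FP _) (const_mem_FP _))

/-- Value of `bitZF`. [folklore] -/
theorem bitZF_apply {c : List Bool → List Bool} {z : List Bool} {b : Bool} (h : c z = [b]) :
    bitZF c z = dpEnc (if b then 1 else 0) := by
  rw [bitZF, Function.comp_apply, iteFn_apply h]
  cases b
  · exact natZF_ones 0
  · exact natZF_ones 1

/-! ### The piece function of family A: the unit edges of the scaled paths -/

/-- The code of `π_e[q]` (family A). [folklore] -/
def paAF : List Bool → List Bool := ptCodeF aeF aqF
/-- The code of `π_e[q+1]` (family A). [folklore] -/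
def pbAF : List Bool → List Bool := ptCodeF aeF (List.cons true ∘ aqF)
/-- The zero offset. [folklore] -/
def z0F : List Bool → List Bool := fun _ => dpEnc 0
/-- Value of `z0F`. [folklore] -/
theorem z0F_apply (z : List Bool) : z0F z = dpEnc 0 := rfl
/-- The code of the unit edge at the position of family A: its two translated end points
`k a + t u + v`, `k a + (t+1) u + v`. [folklore] -/
def edgeAF : List Bool → List Bool :=
  fanoutFn (ptF paAF pbAF atF z0F z0F) (ptF paAF pbAF (List.cons true ∘ atF) z0F z0F)
/-- **The piece function of family A**: the frame `⟨edge code, ε⟩` of the unit edge at position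
`i`, or nothing out of range. [cite: LiskiewiczOgiharaToda2003, §4 (proof of Theorem 7, E₃: the scaled drawing)] -/
def pieceAFn : List Bool → List Bool := iteFn rangeAF (fanoutFn edgeAF fun _ => []) fun _ => []

/-- `paAF ∈ FP`. [folklore] -/
theorem paAF_mem_FP : paAF ∈ FP := ptCodeF_mem_FP aeF_mem_FP aqF_mem_FP
/-- `pbAF ∈ FP`. [folklore] -/
theorem pbAF_mem_FP : pbAF ∈ FP := ptCodeF_mem_FP aeF_mem_FP (comp_mem_FP (cons_mem_FP true) aqF_mem_FP)
/-- `edgeAF ∈ FP`. [folklore] -/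
theorem edgeAF_mem_FP : edgeAF ∈ FP :=
  fanoutFn_mem_FP (ptF_mem_FP paAF_mem_FP pbAF_mem_FP atF_mem_FP (const_mem_FP _) (const_mem_FP _))
    (ptF_mem_FP paAF_mem_FP pbAF_mem_FP (comp_mem_FP (cons_mem_FP true) atF_mem_FP) (const_mem_FP _) (const_mem_FP _))
/-- **`pieceAFn ∈ FP`.** [cite: AroraBarak2009, §1.3 (closure of polynomial time under composition)] -/
theorem pieceAFn_mem_FP : pieceAFn ∈ FP :=
  iteFn_mem_FP rangeAF_mem_FP (fanoutFn_mem_FP edgeAF_mem_FP (const_mem_FP _)) (const_mem_FP _)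

/-- The translated run point in coordinates. [folklore] -/
theorem runPt_add_eq (kk : ℕ) (a b vv : GridPoint) (c : ℕ) :
    runPt kk a (b - a) c + vv =
      ((kk : ℤ) * a.1 + c * (b.1 - a.1) + 0 + vv.1, (kk : ℤ) * a.2 + c * (b.2 - a.2) + 0 + vv.2) := by
  ext
  · rw [Prod.fst_add, runPt_fst]; simp
  · rw [Prod.snd_add, runPt_snd]; simp

/-- The flat piece of family A in closed form, in range. [folklore] -/
theorem scaledPieceAt_of_range {kk : ℕ} {D : List DrawnEdge} (c : GridPoint × GridPoint → List Bool) {e q tt : ℕ}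
    (he : e < D.length) (hq : q + 1 < (D[e]).2.2.length) :
    scaledPieceAt kk D c e q tt =
      boolPair (c (runPt kk ((D[e]).2.2[q]'(by omega)) ((D[e]).2.2[q + 1] - (D[e]).2.2[q]'(by omega)) tt,
        runPt kk ((D[e]).2.2[q]'(by omega)) ((D[e]).2.2[q + 1] - (D[e]).2.2[q]'(by omega)) (tt + 1))) [] := by
  rw [scaledPieceAt, List.getElem?_eq_getElem he]
  simp only [hq, ↓reduceIte, scaledEdge, boolPair_eq, List.append_nil]
  rw [List.getD_eq_getElem _ _ (by omega), List.getD_eq_getElem _ _ hq]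

/-- The flat piece of family A out of range is empty. [folklore] -/
theorem scaledPieceAt_of_not_range {kk : ℕ} {D : List DrawnEdge} (c : GridPoint × GridPoint → List Bool) {e q tt : ℕ}
    (h : ¬ ∃ he : e < D.length, q + 1 < (D[e]).2.2.length) : scaledPieceAt kk D c e q tt = [] := by
  rw [scaledPieceAt]
  by_cases he : e < D.length
  · rw [List.getElem?_eq_getElem he]
    simp only
    rw [if_neg (fun hq => h ⟨he, hq⟩)]
  · rw [List.getElem?_eq_none (not_lt.mp he)]

/-- **The piece function of family A computes the flat pieces**: on the argument `⟨ctx, 1ⁱ⟩` of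
a presentation `(P, D, s, t)`, `pieceAFn` returns `scaledPieceFlat k Λ D (cV v) i` — for every
`i`. [cite: LiskiewiczOgiharaToda2003, §4 (proof of Theorem 7, E₃)] -/
theorem pieceAFn_argOf (P : List GridPoint) (D : List DrawnEdge) (s t Λ k β : ℕ) (v : GridPoint) (i : ℕ) :
    pieceAFn (argOf P D s t Λ k β v i) = scaledPieceFlat k Λ D (cV v) i := by
  rw [pieceAFn, iteFn_of_oneBit oneBit_rangeAF, scaledPieceFlat_eq]
  by_cases hr : rangeAF (argOf P D s t Λ k β v i) = [true]
  · obtain ⟨he, hq⟩ := (rangeAF_argOf_eq_true_iff P s t β v D Λ k i).mp hr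
    have ha : paAF (argOf P D s t Λ k β v i) = encPt ((D[idxAE Λ k i]).2.2[idxAQ Λ k i]'(by omega)) :=
      ptCodeF_argOf (eF := aeF) (qF := aqF) (aeF_arg _ _ _ _ _ _) he (aqF_arg _ _ _ _ _ _) (by omega)
    have hb : pbAF (argOf P D s t Λ k β v i) = encPt ((D[idxAE Λ k i]).2.2[idxAQ Λ k i + 1]) :=
      ptCodeF_argOf (eF := aeF) (qF := List.cons true ∘ aqF) (aeF_arg _ _ _ _ _ _) he
        (by rw [Function.comp_apply, aqF_arg, ← Com.ones_succ]) hq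
    rw [if_pos hr, scaledPieceAt_of_range _ he hq, fanoutFn_apply, edgeAF, fanoutFn_apply,
      ptF_apply (ukF_arg _ _ _ _ _ _) (v1F_arg _ _ _ _ _ _) (v2F_arg _ _ _ _ _ _) ha hb (atF_arg _ _ _ _ _ _)
        (z0F_apply _) (z0F_apply _),
      ptF_apply (cF := List.cons true ∘ atF) (ukF_arg _ _ _ _ _ _) (v1F_arg _ _ _ _ _ _) (v2F_arg _ _ _ _ _ _) ha hb
        (by rw [Function.comp_apply, atF_arg, ← Com.ones_succ]) (z0F_apply _) (z0F_apply _),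
      cV_eq, runPt_add_eq, runPt_add_eq]
  · rw [if_neg hr, scaledPieceAt_of_not_range _ (fun h => hr ((rangeAF_argOf_eq_true_iff P s t β v D Λ k i).mpr h))]

/-! ### The piece function of family B: the new edges of the squares -/

/-- The code of `π_e[0]` (family B). [folklore] -/
def p0BF : List Bool → List Bool := ptCodeF beF fun _ => []
/-- The code of `π_e[1]` (family B). [folklore] -/
def p1BF : List Bool → List Bool := ptCodeF beF fun _ => [true]
/-- `[u.2 = 0]` for the first unit step `u = π_e[1] - π_e[0]` (decides `sideVec u`). [folklore] -/
def zU2F : List Bool → List Bool := isZeroZF ∘ u2F p0BF p1BF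
/-- `[1 ≤ m]`. [folklore] -/
def mge1F : List Bool → List Bool := notFn (isNilFn ∘ bmF)
/-- `[m = 2]` (`1 < m`, as `m < 3`). [folklore] -/
def meq2F : List Bool → List Bool := ltLenF ∘ fanoutFn (fun _ => [true]) bmF
/-- `[m ≤ 1]`. [folklore] -/
def mle1F : List Bool → List Bool := notFn meq2F
/-- `1^{2j+2}`: the column of the first foot of square `j`. [folklore] -/
def colF : List Bool → List Bool := onesMulFn 2 ∘ List.cons true ∘ bjF
/-- The column of the first end point of the `m`-th new edge: `2j+2`, `+1` when `m = 2`. [folklore] -/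
def col1F : List Bool → List Bool := iteFn meq2F (List.cons true ∘ colF) colF
/-- The column of the second end point: `2j+2`, `+1` when `1 ≤ m`. [folklore] -/
def col2F : List Bool → List Bool := iteFn mge1F (List.cons true ∘ colF) colF
/-- First-coordinate offset of an end point on the side of the square (bit `sF`): `1` iff the
step is vertical (`u.2 ≠ 0`). [folklore] -/
def off1F (sF : List Bool → List Bool) : List Bool → List Bool := bitZF (andFn sF (notFn zU2F))
/-- Second-coordinate offset: `1` iff the step is horizontal (`u.2 = 0`). [folklore] -/
def off2F (sF : List Bool → List Bool) : List Bool → List Bool := bitZF (andFn sF zU2F)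
/-- The code of the `m`-th new edge of the `j`-th square of `D[e]`: its two translated end
points (the first on the side iff `1 ≤ m`, the second iff `m ≤ 1`). [folklore] -/
def edgeBF : List Bool → List Bool :=
  fanoutFn (ptF p0BF p1BF col1F (off1F mge1F) (off2F mge1F)) (ptF p0BF p1BF col2F (off1F mle1F) (off2F mle1F))
/-- **The piece function of family B**: the frame `⟨edge code, ε⟩` of the new edge at position
`i`, or nothing out of range. [cite: LiskiewiczOgiharaToda2003, §4 (proof of Theorem 7, E₃: "attach above the line β unit-size squares")] -/
def pieceBFn : List Bool → List Bool := iteFn cB1F (fanoutFn edgeBF fun _ => []) fun _ => []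

/-- `p0BF ∈ FP`. [folklore] -/
theorem p0BF_mem_FP : p0BF ∈ FP := ptCodeF_mem_FP beF_mem_FP (const_mem_FP _)
/-- `p1BF ∈ FP`. [folklore] -/
theorem p1BF_mem_FP : p1BF ∈ FP := ptCodeF_mem_FP beF_mem_FP (const_mem_FP _)
/-- `zU2F ∈ FP`. [folklore] -/
theorem zU2F_mem_FP : zU2F ∈ FP := comp_mem_FP isZeroZF_mem_FP (u2F_mem_FP p0BF_mem_FP p1BF_mem_FP)
/-- `mge1F ∈ FP`. [folklore] -/
theorem mge1F_mem_FP : mge1F ∈ FP := notFn_mem_FP (comp_mem_FP isNilFn_mem_FP bmF_mem_FP)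
/-- `meq2F ∈ FP`. [folklore] -/
theorem meq2F_mem_FP : meq2F ∈ FP := comp_mem_FP ltLenF_mem_FP (fanoutFn_mem_FP (const_mem_FP _) bmF_mem_FP)
/-- `mle1F ∈ FP`. [folklore] -/
theorem mle1F_mem_FP : mle1F ∈ FP := notFn_mem_FP meq2F_mem_FP
/-- `colF ∈ FP`. [folklore] -/
theorem colF_mem_FP : colF ∈ FP :=
  comp_mem_FP (onesMulFn_mem_FP 2) (comp_mem_FP (cons_mem_FP true) bjF_mem_FP)
/-- `col1F ∈ FP`. [folklore] -/
theorem col1F_mem_FP : col1F ∈ FP := iteFn_mem_FP meq2F_mem_FP (comp_mem_FP (cons_mem_FP true) colF_mem_FP) colF_mem_FP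
/-- `col2F ∈ FP`. [folklore] -/
theorem col2F_mem_FP : col2F ∈ FP := iteFn_mem_FP mge1F_mem_FP (comp_mem_FP (cons_mem_FP true) colF_mem_FP) colF_mem_FP
/-- `off1F sF ∈ FP`. [folklore] -/
theorem off1F_mem_FP {sF : List Bool → List Bool} (h : sF ∈ FP) : off1F sF ∈ FP :=
  bitZF_mem_FP (andFn_mem_FP h (notFn_mem_FP zU2F_mem_FP))
/-- `off2F sF ∈ FP`. [folklore] -/
theorem off2F_mem_FP {sF : List Bool → List Bool} (h : sF ∈ FP) : off2F sF ∈ FP :=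
  bitZF_mem_FP (andFn_mem_FP h zU2F_mem_FP)
/-- `edgeBF ∈ FP`. [folklore] -/
theorem edgeBF_mem_FP : edgeBF ∈ FP :=
  fanoutFn_mem_FP (ptF_mem_FP p0BF_mem_FP p1BF_mem_FP col1F_mem_FP (off1F_mem_FP mge1F_mem_FP) (off2F_mem_FP mge1F_mem_FP))
    (ptF_mem_FP p0BF_mem_FP p1BF_mem_FP col2F_mem_FP (off1F_mem_FP mle1F_mem_FP) (off2F_mem_FP mle1F_mem_FP))
/-- **`pieceBFn ∈ FP`.** [cite: AroraBarak2009, §1.3 (closure of polynomial time under composition)] -/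
theorem pieceBFn_mem_FP : pieceBFn ∈ FP :=
  iteFn_mem_FP cB1F_mem_FP (fanoutFn_mem_FP edgeBF_mem_FP (const_mem_FP _)) (const_mem_FP _)

/-- `mge1F` is one-bit. [folklore] -/
theorem oneBit_mge1F : OneBit mge1F := oneBit_notFn (oneBit_isNilFn.comp _)
/-- `meq2F` is one-bit. [folklore] -/
theorem oneBit_meq2F : OneBit meq2F := oneBit_ltLenF.comp _
/-- `mle1F` is one-bit. [folklore] -/
theorem oneBit_mle1F : OneBit mle1F := oneBit_notFn oneBit_meq2F

/-- **An end point of a new edge of a square**, semantically: the run point `c` of the scaled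
first unit step `p → q` of the drawn edge, moved onto the side of the square when `b`
(`cornerOf k p u c = runPt k p u c + sideVec u`). [folklore] -/
def sqEdgePt (k : ℕ) (d : DrawnEdge) (c : ℕ) (b : Bool) : GridPoint :=
  runPt k (d.2.2.getD 0 0) (d.2.2.getD 1 0 - d.2.2.getD 0 0) c +
    if b then sideVec (d.2.2.getD 1 0 - d.2.2.getD 0 0) else 0

/-- **The three new edges of a square by position**: for a drawn path with at least two points,
the `m`-th edge of `sqSite k d j` (`m < 3`: `p p′`, `p′ q′`, `q′ q`) joins the end point of
column `2j+2 + [m = 2]`, on the side iff `1 ≤ m`, to the end point of column `2j+2 + [1 ≤ m]`,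
on the side iff `m ≤ 1`. [cite: LiskiewiczOgiharaToda2003, §4 (proof of Theorem 7, E₃, Fig. 8)] -/
theorem getElem?_edges_sqSite (k : ℕ) {d : DrawnEdge} (h2 : 2 ≤ d.2.2.length) (j : ℕ) {m : ℕ} (hm : m < 3) :
    ((sqSite k d j).edges)[m]? =
      some (sqEdgePt k d (if m = 2 then 2 * j + 3 else 2 * j + 2) (decide (1 ≤ m)),
        sqEdgePt k d (if 1 ≤ m then 2 * j + 3 else 2 * j + 2) (decide (m ≤ 1))) := by
  obtain ⟨p, q, l, hπ⟩ : ∃ p q l, d.2.2 = p :: q :: l := by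
    match h : d.2.2, h2 with
    | p :: q :: l, _ => exact ⟨p, q, l, rfl⟩
  simp only [SquareSite.edges, sqSite, sqEdgePt, hπ, firstStep, List.getD_cons_zero, List.getD_cons_succ, cornerOf]
  interval_cases m <;> simp

/-- Coordinates of `sideVec`. [folklore] -/
theorem sideVec_fst (u : GridPoint) : (sideVec u).1 = if u.2 = 0 then 0 else 1 := by
  unfold sideVec; split_ifs <;> rfl
/-- Coordinates of `sideVec`. [folklore] -/
theorem sideVec_snd (u : GridPoint) : (sideVec u).2 = if u.2 = 0 then 1 else 0 := by
  unfold sideVec; split_ifs <;> rfl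

/-- The translated end point in coordinates. [folklore] -/
theorem sqEdgePt_add_eq (kk : ℕ) {d : DrawnEdge} (h2 : 2 ≤ d.2.2.length) (c : ℕ) (b : Bool) (vv : GridPoint) :
    sqEdgePt kk d c b + vv =
      ((kk : ℤ) * (d.2.2[0]'(by omega)).1 + c * ((d.2.2[1]'(by omega)).1 - (d.2.2[0]'(by omega)).1) +
          (if (b && !decide ((d.2.2[1]'(by omega)).2 - (d.2.2[0]'(by omega)).2 = 0)) then 1 else 0) + vv.1,
        (kk : ℤ) * (d.2.2[0]'(by omega)).2 + c * ((d.2.2[1]'(by omega)).2 - (d.2.2[0]'(by omega)).2) +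
          (if (b && decide ((d.2.2[1]'(by omega)).2 - (d.2.2[0]'(by omega)).2 = 0)) then 1 else 0) + vv.2) := by
  rw [sqEdgePt, List.getD_eq_getElem _ _ (by omega), List.getD_eq_getElem _ _ (by omega)]
  ext
  · simp only [Prod.fst_add, runPt_fst, Prod.fst_sub]
    cases b
    · simp
    · simp only [↓reduceIte, sideVec_fst, Prod.snd_sub, Bool.true_and, Bool.not_eq_true', decide_eq_false_iff_not]
      split_ifs <;> simp
  · simp only [Prod.snd_add, runPt_snd, Prod.snd_sub]
    cases b
    · simp
    · simp only [↓reduceIte, sideVec_snd, Prod.snd_sub, Bool.true_and, decide_eq_true_eq]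

/-- The flat piece of family B in closed form, in range. [folklore] -/
theorem squarePieceAt_of_range {kk : ℕ} {D : List DrawnEdge} (c : GridPoint × GridPoint → List Bool) {e j m : ℕ}
    (he : e < D.length) (h2 : 2 ≤ (D[e]).2.2.length) (hm : m < 3) :
    squarePieceAt kk D c e j m =
      boolPair (c (sqEdgePt kk (D[e]) (if m = 2 then 2 * j + 3 else 2 * j + 2) (decide (1 ≤ m)),
        sqEdgePt kk (D[e]) (if 1 ≤ m then 2 * j + 3 else 2 * j + 2) (decide (m ≤ 1)))) [] := by
  rw [squarePieceAt, List.getElem?_eq_getElem he]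
  simp only
  rw [getElem?_edges_sqSite kk h2 j hm, boolPair_eq, List.append_nil]

/-- The flat piece of family B out of range is empty. [folklore] -/
theorem squarePieceAt_of_not_range {kk : ℕ} {D : List DrawnEdge} (c : GridPoint × GridPoint → List Bool) {e j m : ℕ}
    (he : ¬ e < D.length) : squarePieceAt kk D c e j m = [] := by
  rw [squarePieceAt, List.getElem?_eq_none (not_lt.mp he)]

section BApply

variable (P : List GridPoint) {D : List DrawnEdge} (s t Λ k : ℕ) {β : ℕ} (v : GridPoint) {i : ℕ}

/-- Value of `p0BF`. [folklore] -/
theorem p0BF_argOf (he : idxBE β i < D.length) (h2 : 2 ≤ (D[idxBE β i]).2.2.length) :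
    p0BF (argOf P D s t Λ k β v i) = encPt ((D[idxBE β i]).2.2[0]) :=
  ptCodeF_argOf (eF := beF) (qF := fun _ => []) (q := 0) (beF_arg _ _ _ _ _ _) he rfl (by omega)
/-- Value of `p1BF`. [folklore] -/
theorem p1BF_argOf (he : idxBE β i < D.length) (h2 : 2 ≤ (D[idxBE β i]).2.2.length) :
    p1BF (argOf P D s t Λ k β v i) = encPt ((D[idxBE β i]).2.2[1]) :=
  ptCodeF_argOf (eF := beF) (qF := fun _ => [true]) (q := 1) (beF_arg _ _ _ _ _ _) he rfl (by omega)
/-- Value of `zU2F`. [folklore] -/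
theorem zU2F_argOf (he : idxBE β i < D.length) (h2 : 2 ≤ (D[idxBE β i]).2.2.length) :
    zU2F (argOf P D s t Λ k β v i) = [decide (((D[idxBE β i]).2.2[1]).2 - ((D[idxBE β i]).2.2[0]).2 = 0)] := by
  rw [zU2F, Function.comp_apply, u2F, Function.comp_apply, fanoutFn_apply, a2F, Function.comp_apply,
    Function.comp_apply, Function.comp_apply, Function.comp_apply, p1BF_argOf P s t Λ k v he h2,
    p0BF_argOf P s t Λ k v he h2, encPt_eq, encPt_eq, sndF_boolPair, sndF_boolPair, ofSMFn_encInt, ofSMFn_encInt,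
    zsubF_boolPair, ival_dpEnc, ival_dpEnc, isZeroZF_dpEnc]
/-- Value of `mge1F`. [folklore] -/
theorem mge1F_argOf (β i : ℕ) : mge1F (argOf P D s t Λ k β v i) = [decide (1 ≤ idxBM β i)] := by
  have h : (isNilFn ∘ bmF) (argOf P D s t Λ k β v i) = [decide (idxBM β i = 0)] := by
    rw [Function.comp_apply, bmF_arg]; simp [isNilFn, ones, List.replicate_eq_nil_iff]
  rw [mge1F, notFn_apply h]
  congr 1; rw [Bool.eq_iff_iff]; simp; omega
/-- Value of `meq2F` (with `m < 3`). [folklore] -/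
theorem meq2F_argOf (β i : ℕ) : meq2F (argOf P D s t Λ k β v i) = [decide (idxBM β i = 2)] := by
  rw [meq2F, Function.comp_apply, fanoutFn_apply, bmF_arg, show [true] = ones 1 from rfl, ltLenF_ones]
  have hm : idxBM β i < 3 := Nat.mod_lt _ (by norm_num)
  congr 1; rw [Bool.eq_iff_iff]; simp; omega
/-- Value of `mle1F`. [folklore] -/
theorem mle1F_argOf (β i : ℕ) : mle1F (argOf P D s t Λ k β v i) = [decide (idxBM β i ≤ 1)] := by
  rw [mle1F, notFn_apply (meq2F_argOf P s t Λ k v β i)]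
  have hm : idxBM β i < 3 := Nat.mod_lt _ (by norm_num)
  congr 1; rw [Bool.eq_iff_iff]; simp; omega
/-- Value of `colF`. [folklore] -/
theorem colF_argOf (β i : ℕ) : colF (argOf P D s t Λ k β v i) = ones (2 * idxBJ β i + 2) := by
  rw [colF, Function.comp_apply, Function.comp_apply, bjF_arg, ← Com.ones_succ, onesMulFn_ones]
  congr 1
/-- Value of `col1F`. [folklore] -/
theorem col1F_argOf (β i : ℕ) :
    col1F (argOf P D s t Λ k β v i) = ones (if idxBM β i = 2 then 2 * idxBJ β i + 3 else 2 * idxBJ β i + 2) := by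
  rw [col1F, iteFn_apply (meq2F_argOf P s t Λ k v β i)]
  by_cases h : idxBM β i = 2
  · simp only [h, decide_true, ↓reduceIte, Function.comp_apply]
    rw [colF_argOf, ← Com.ones_succ]
  · simp only [h, decide_false, Bool.false_eq_true, ↓reduceIte]
    exact colF_argOf P s t Λ k v β i
/-- Value of `col2F`. [folklore] -/
theorem col2F_argOf (β i : ℕ) :
    col2F (argOf P D s t Λ k β v i) = ones (if 1 ≤ idxBM β i then 2 * idxBJ β i + 3 else 2 * idxBJ β i + 2) := by
  rw [col2F, iteFn_apply (mge1F_argOf P s t Λ k v β i)]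
  by_cases h : 1 ≤ idxBM β i
  · simp only [h, decide_true, ↓reduceIte, Function.comp_apply]
    rw [colF_argOf, ← Com.ones_succ]
  · simp only [h, decide_false, Bool.false_eq_true, ↓reduceIte]
    exact colF_argOf P s t Λ k v β i
/-- Value of `off1F`. [folklore] -/
theorem off1F_argOf {sF : List Bool → List Bool} {b : Bool} (hs : sF (argOf P D s t Λ k β v i) = [b])
    (he : idxBE β i < D.length) (h2 : 2 ≤ (D[idxBE β i]).2.2.length) :
    off1F sF (argOf P D s t Λ k β v i) =
      dpEnc (if (b && !decide (((D[idxBE β i]).2.2[1]).2 - ((D[idxBE β i]).2.2[0]).2 = 0)) then 1 else 0) := by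
  rw [off1F, bitZF_apply (andFn_apply hs (notFn_apply (zU2F_argOf P s t Λ k v he h2)))]
/-- Value of `off2F`. [folklore] -/
theorem off2F_argOf {sF : List Bool → List Bool} {b : Bool} (hs : sF (argOf P D s t Λ k β v i) = [b])
    (he : idxBE β i < D.length) (h2 : 2 ≤ (D[idxBE β i]).2.2.length) :
    off2F sF (argOf P D s t Λ k β v i) =
      dpEnc (if (b && decide (((D[idxBE β i]).2.2[1]).2 - ((D[idxBE β i]).2.2[0]).2 = 0)) then 1 else 0) := by
  rw [off2F, bitZF_apply (andFn_apply hs (zU2F_argOf P s t Λ k v he h2))]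

end BApply

/-- **The piece function of family B computes the flat pieces**: on the argument `⟨ctx, 1ⁱ⟩`
of a presentation whose drawn paths have at least two points each (true for a valid drawing),
`pieceBFn` returns `squarePieceFlat k β D (cV v) i` — for every `i`.
[cite: LiskiewiczOgiharaToda2003, §4 (proof of Theorem 7, E₃)] -/
theorem pieceBFn_argOf (P : List GridPoint) {D : List DrawnEdge} (hD : ∀ d ∈ D, 2 ≤ d.2.2.length)
    (s t Λ k β : ℕ) (v : GridPoint) (i : ℕ) :
    pieceBFn (argOf P D s t Λ k β v i) = squarePieceFlat k β D (cV v) i := by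
  rw [pieceBFn, iteFn_of_oneBit oneBit_cB1F, squarePieceFlat_eq, cB1F_argOf]
  by_cases he : idxBE β i < D.length
  · have h2 : 2 ≤ (D[idxBE β i]).2.2.length := hD _ (List.getElem_mem he)
    have hm : idxBM β i < 3 := Nat.mod_lt _ (by norm_num)
    rw [if_pos (by simp [he]), squarePieceAt_of_range _ he h2 hm, fanoutFn_apply, edgeBF, fanoutFn_apply,
      ptF_apply (ukF_arg _ _ _ _ _ _) (v1F_arg _ _ _ _ _ _) (v2F_arg _ _ _ _ _ _) (p0BF_argOf P s t Λ k v he h2)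
        (p1BF_argOf P s t Λ k v he h2) (col1F_argOf P s t Λ k v β i)
        (off1F_argOf P s t Λ k v (mge1F_argOf P s t Λ k v β i) he h2)
        (off2F_argOf P s t Λ k v (mge1F_argOf P s t Λ k v β i) he h2),
      ptF_apply (ukF_arg _ _ _ _ _ _) (v1F_arg _ _ _ _ _ _) (v2F_arg _ _ _ _ _ _) (p0BF_argOf P s t Λ k v he h2)
        (p1BF_argOf P s t Λ k v he h2) (col2F_argOf P s t Λ k v β i)
        (off1F_argOf P s t Λ k v (mle1F_argOf P s t Λ k v β i) he h2)
        (off2F_argOf P s t Λ k v (mle1F_argOf P s t Λ k v β i) he h2),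
      cV_eq, sqEdgePt_add_eq _ h2, sqEdgePt_add_eq _ h2]
    push_cast
    rfl
  · rw [if_neg (by simp [he]), squarePieceAt_of_not_range _ he]


/-! ### The size of the pieces on the generators' own trajectory -/

/-- A coordinate of a translated point: `|M a + c u + e + v| ≤ M |a| + c + 1 + |v|` for `|u|, |e| ≤ 1`.
[folklore] -/
theorem natAbs_coord_le' (M : ℕ) (a : ℤ) {u e : ℤ} (c : ℕ) (v : ℤ) (hu : u.natAbs ≤ 1) (he : e.natAbs ≤ 1) :
    ((M : ℤ) * a + c * u + e + v).natAbs ≤ M * a.natAbs + c + 1 + v.natAbs := by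
  have e1 : ((M : ℤ) * a).natAbs = M * a.natAbs := by rw [Int.natAbs_mul]; simp
  have e2 : ((c : ℤ) * u).natAbs ≤ c := by
    rw [Int.natAbs_mul, Int.natAbs_natCast]; exact (Nat.mul_le_mul_left c hu).trans (by omega)
  calc ((M : ℤ) * a + c * u + e + v).natAbs ≤ ((M : ℤ) * a + c * u + e).natAbs + v.natAbs := Int.natAbs_add_le _ _
    _ ≤ ((M : ℤ) * a + c * u).natAbs + e.natAbs + v.natAbs := by gcongr; exact Int.natAbs_add_le _ _
    _ ≤ ((M : ℤ) * a).natAbs + ((c : ℤ) * u).natAbs + e.natAbs + v.natAbs := by gcongr; exact Int.natAbs_add_le _ _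
    _ ≤ M * a.natAbs + c + 1 + v.natAbs := by rw [e1]; omega

/-- Size of a bounded coordinate: for `A, V < 2ⁿ`, `M ≤ n`, `c ≤ 3n`, a natural number
`X ≤ M A + c + 1 + V` has at most `2n + 3` binary digits. [folklore] -/
theorem size_coord_le' {M A V c n X : ℕ} (hA : A.size ≤ n) (hV : V.size ≤ n) (hM : M ≤ n) (hc : c ≤ 3 * n)
    (hX : X ≤ M * A + c + 1 + V) : X.size ≤ 2 * n + 3 := by
  rw [Nat.size_le] at hA hV ⊢
  have hn : n < 2 ^ n := Nat.lt_two_pow_self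
  have h1 : (1 : ℕ) ≤ 2 ^ n := Nat.one_le_two_pow
  have hMA : M * A ≤ 2 ^ n * 2 ^ n := Nat.mul_le_mul (hM.trans hn.le) hA.le
  have hpp : 2 ^ n ≤ 2 ^ n * 2 ^ n := Nat.le_mul_of_pos_left _ (by positivity)
  have h8 : 2 ^ (2 * n + 3) = 8 * (2 ^ n * 2 ^ n) := by
    rw [← pow_add, show 2 * n + 3 = (n + n) + 3 by ring, pow_add]; ring
  rw [h8]
  omega

/-- The clipping constant of the generators. [folklore] -/
def sqClip : ℕ := 250

section Sizes

variable (P : List GridPoint) {D : List DrawnEdge} (s t : ℕ) (Λ k β : ℕ) (v : GridPoint)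

/-- The fields are parts of the context. [folklore] -/
theorem le_length_ctx (w : List Bool) :
    w.length ≤ (ctx w Λ k β v).length ∧ Λ ≤ (ctx w Λ k β v).length ∧ k ≤ (ctx w Λ k β v).length ∧
      β ≤ (ctx w Λ k β v).length ∧ (dpEnc v.1).length ≤ (ctx w Λ k β v).length ∧
      (dpEnc v.2).length ≤ (ctx w Λ k β v).length := by
  simp only [ctx, length_boolPair, ones, List.length_replicate]
  omega

/-- **A translated point of the instance has a short code**: for a point `a` of a drawn path of
the presentation, a step `u` with unit components, a column `c ≤ 3 |ctx|` and offsets of modulus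
at most one, the code of `k a + c u + ε + v` has at most `6 |ctx| + 23` symbols. [folklore] -/
theorem length_encPt_coord_le {d : DrawnEdge} (hd : d ∈ D) {a : GridPoint} (ha : a ∈ d.2.2) {u1 u2 ε₁ ε₂ : ℤ}
    (hu1 : u1.natAbs ≤ 1) (hu2 : u2.natAbs ≤ 1) (he1 : ε₁.natAbs ≤ 1) (he2 : ε₂.natAbs ≤ 1) {c : ℕ}
    (hc : c ≤ 3 * (ctx (encodingDrawnGraphInstance.encode (P, D, s, t)) Λ k β v).length) :
    (encPt ((k : ℤ) * a.1 + c * u1 + ε₁ + v.1, (k : ℤ) * a.2 + c * u2 + ε₂ + v.2)).length ≤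
      6 * (ctx (encodingDrawnGraphInstance.encode (P, D, s, t)) Λ k β v).length + 23 := by
  set L := (ctx (encodingDrawnGraphInstance.encode (P, D, s, t)) Λ k β v).length with hL
  obtain ⟨hw, -, hkL, -, hv1, hv2⟩ := le_length_ctx Λ k β v (encodingDrawnGraphInstance.encode (P, D, s, t))
  have hpt := length_encPt_le P s t hd ha
  have hsz := size_natAbs_le_length_encPt a
  have hszv1 := size_natAbs_le_length_dpEnc v.1
  have hszv2 := size_natAbs_le_length_dpEnc v.2
  refine (length_encPt_le_of_size (n := 2 * L + 3) ?_ ?_).trans (by omega)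
  · exact size_coord_le' (hsz.1.trans (hpt.trans hw)) (hszv1.trans hv1) hkL hc
      (natAbs_coord_le' k a.1 c v.1 hu1 he1)
  · exact size_coord_le' (hsz.2.trans (hpt.trans hw)) (hszv2.trans hv2) hkL hc
      (natAbs_coord_le' k a.2 c v.2 hu2 he2)

/-- Unit steps have components of modulus at most one. [folklore] -/
theorem natAbs_le_one_of_isUnitVec {u : GridPoint} (hu : IsUnitVec u) : u.1.natAbs ≤ 1 ∧ u.2.natAbs ≤ 1 := by
  rcases hu.cases with ⟨h1, h2⟩ | ⟨h1, h2⟩ | ⟨h1, h2⟩ | ⟨h1, h2⟩ <;> simp [h1, h2]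

variable {Λ k β}

/-- **The pieces of family A are short on the generator's trajectory**: for a valid drawing and
`0 < k`, every piece is at most `sqClip · (|ctx| + 1)` symbols long. [folklore] -/
theorem length_pieceAFn_argOf_le (hD : IsGridDrawing P D) (hk : 0 < k) (i : ℕ) :
    (pieceAFn (argOf P D s t Λ k β v i)).length ≤
      sqClip * ((ctx (encodingDrawnGraphInstance.encode (P, D, s, t)) Λ k β v).length + 1) := by
  rw [pieceAFn_argOf, scaledPieceFlat_eq]
  by_cases hr : ∃ he : idxAE Λ k i < D.length, idxAQ Λ k i + 1 < (D[idxAE Λ k i]).2.2.length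
  · obtain ⟨he, hq⟩ := hr
    rw [scaledPieceAt_of_range _ he hq, length_boolPair, cV_eq, length_boolPair, List.length_nil,
      runPt_add_eq, runPt_add_eq]
    have hdD : D[idxAE Λ k i] ∈ D := List.getElem_mem he
    have hu : IsUnitVec ((D[idxAE Λ k i]).2.2[idxAQ Λ k i + 1] - (D[idxAE Λ k i]).2.2[idxAQ Λ k i]'(by omega)) :=
      isUnitVec_step (hD.2.1 _ hdD).2.2.2.2.2.2.1 hq
    obtain ⟨hu1, hu2⟩ := natAbs_le_one_of_isUnitVec hu
    rw [Prod.fst_sub] at hu1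
    rw [Prod.snd_sub] at hu2
    have ht : idxAT Λ k i < k := Nat.mod_lt _ hk
    obtain ⟨-, -, hkL, -⟩ := le_length_ctx Λ k β v (encodingDrawnGraphInstance.encode (P, D, s, t))
    have k1 := length_encPt_coord_le P s t Λ k β v hdD (a := (D[idxAE Λ k i]).2.2[idxAQ Λ k i]'(by omega))
      (List.getElem_mem _) hu1 hu2 (ε₁ := 0) (ε₂ := 0) (by simp) (by simp) (c := idxAT Λ k i) (by omega)
    have k2 := length_encPt_coord_le P s t Λ k β v hdD (a := (D[idxAE Λ k i]).2.2[idxAQ Λ k i]'(by omega))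
      (List.getElem_mem _) hu1 hu2 (ε₁ := 0) (ε₂ := 0) (by simp) (by simp) (c := idxAT Λ k i + 1) (by omega)
    simp only [sqClip]
    omega
  · rw [scaledPieceAt_of_not_range _ hr]
    simp

/-- The modulus of a bit offset. [folklore] -/
theorem natAbs_bif_le_one (b : Bool) : (if b then (1 : ℤ) else 0).natAbs ≤ 1 := by
  cases b <;> simp

/-- **The pieces of family B are short on the generator's trajectory**: for a valid drawing and
`0 < β`, every piece is at most `sqClip · (|ctx| + 1)` symbols long. [folklore] -/
theorem length_pieceBFn_argOf_le (hD : IsGridDrawing P D) (hβ : 0 < β) (i : ℕ) :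
    (pieceBFn (argOf P D s t Λ k β v i)).length ≤
      sqClip * ((ctx (encodingDrawnGraphInstance.encode (P, D, s, t)) Λ k β v).length + 1) := by
  have hD2 : ∀ d ∈ D, 2 ≤ d.2.2.length := two_le_length_of_mem hD
  rw [pieceBFn_argOf P hD2, squarePieceFlat_eq]
  by_cases he : idxBE β i < D.length
  · have h2 : 2 ≤ (D[idxBE β i]).2.2.length := hD2 _ (List.getElem_mem he)
    have hm : idxBM β i < 3 := Nat.mod_lt _ (by norm_num)
    rw [squarePieceAt_of_range _ he h2 hm, length_boolPair, cV_eq, length_boolPair, List.length_nil,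
      sqEdgePt_add_eq _ h2, sqEdgePt_add_eq _ h2]
    have hdD : D[idxBE β i] ∈ D := List.getElem_mem he
    have hu : IsUnitVec ((D[idxBE β i]).2.2[0 + 1]'(by omega) - (D[idxBE β i]).2.2[0]'(by omega)) :=
      isUnitVec_step (i := 0) (hD.2.1 _ hdD).2.2.2.2.2.2.1 (by omega)
    obtain ⟨hu1, hu2⟩ := natAbs_le_one_of_isUnitVec hu
    simp only [Nat.zero_add, Prod.fst_sub, Prod.snd_sub] at hu1 hu2
    obtain ⟨-, -, -, hβL, -⟩ := le_length_ctx Λ k β v (encodingDrawnGraphInstance.encode (P, D, s, t))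
    have hL2 : 2 ≤ (ctx (encodingDrawnGraphInstance.encode (P, D, s, t)) Λ k β v).length := by
      rw [ctx, length_boolPair]; omega
    have hj : idxBJ β i < β := by
      refine Nat.div_lt_of_lt_mul ?_
      rw [Nat.mul_comm]
      exact Nat.mod_lt _ (by omega)
    have k1 := length_encPt_coord_le P s t Λ k β v hdD (a := (D[idxBE β i]).2.2[0]'(by omega))
      (List.getElem_mem _) hu1 hu2
      (natAbs_bif_le_one (decide (1 ≤ idxBM β i) &&
        !decide (((D[idxBE β i]).2.2[1]'(by omega)).2 - ((D[idxBE β i]).2.2[0]'(by omega)).2 = 0)))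
      (natAbs_bif_le_one (decide (1 ≤ idxBM β i) &&
        decide (((D[idxBE β i]).2.2[1]'(by omega)).2 - ((D[idxBE β i]).2.2[0]'(by omega)).2 = 0)))
      (c := if idxBM β i = 2 then 2 * idxBJ β i + 3 else 2 * idxBJ β i + 2) (by split_ifs <;> omega)
    have k2 := length_encPt_coord_le P s t Λ k β v hdD (a := (D[idxBE β i]).2.2[0]'(by omega))
      (List.getElem_mem _) hu1 hu2
      (natAbs_bif_le_one (decide (idxBM β i ≤ 1) &&
        !decide (((D[idxBE β i]).2.2[1]'(by omega)).2 - ((D[idxBE β i]).2.2[0]'(by omega)).2 = 0)))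
      (natAbs_bif_le_one (decide (idxBM β i ≤ 1) &&
        decide (((D[idxBE β i]).2.2[1]'(by omega)).2 - ((D[idxBE β i]).2.2[0]'(by omega)).2 = 0)))
      (c := if 1 ≤ idxBM β i then 2 * idxBJ β i + 3 else 2 * idxBJ β i + 2) (by split_ifs <;> omega)
    simp only [sqClip]
    omega
  · rw [squarePieceAt_of_not_range _ he]
    simp

end Sizes

/-! ### The two items generators: folding the clipped pieces -/

/-- **The generator of family A**: fold the clipped piece function over `genPoly |ctx|` positions
and return the accumulator — the framed codes of the translated unit edges of the scaled paths.
[cite: LiskiewiczOgiharaToda2003, §4 (proof of Theorem 7: R₁ computes E₃)] -/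
def genAFn : List Bool → List Bool :=
  sndPow 2 ∘ foldLoop appF (clipF sqClip pieceAFn) genPoly ∘ genInitF

/-- **The generator of family B** (the squares). [cite: LiskiewiczOgiharaToda2003, §4 (proof of Theorem 7: R₁ computes E₃)] -/
def genBFn : List Bool → List Bool :=
  sndPow 2 ∘ foldLoop appF (clipF sqClip pieceBFn) genPoly ∘ genInitF

/-- **`genAFn ∈ FP`** (the clipped fold of `FoldBricks.lean`). [cite: AroraBarak2009, §1.3 (bounded loops)] -/
theorem genAFn_mem_FP : genAFn ∈ FP :=
  comp_mem_FP (sndPow_mem_FP 2) (comp_mem_FP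
    (foldLoop_clipF_mem_FP sqClip appF_mem_FP length_appF_le pieceAFn_mem_FP genPoly) genInitF_mem_FP)

/-- **`genBFn ∈ FP`.** [cite: AroraBarak2009, §1.3 (bounded loops)] -/
theorem genBFn_mem_FP : genBFn ∈ FP :=
  comp_mem_FP (sndPow_mem_FP 2) (comp_mem_FP
    (foldLoop_clipF_mem_FP sqClip appF_mem_FP length_appF_le pieceBFn_mem_FP genPoly) genInitF_mem_FP)

/-- Past the last position every flat piece of family A is empty. [folklore] -/
theorem scaledPieceFlat_eq_nil_of_le {Λ k : ℕ} (hΛ : 1 ≤ Λ) (hk : 0 < k) (D : List DrawnEdge)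
    (c : GridPoint × GridPoint → List Bool) {i : ℕ} (hi : scaledTotal k Λ D ≤ i) : scaledPieceFlat k Λ D c i = [] := by
  rw [scaledPieceFlat_eq, scaledPieceAt, List.getElem?_eq_none]
  rw [idxAE, Nat.le_div_iff_mul_le (Nat.mul_pos (by omega) hk)]
  exact hi

/-- Past the last position every flat piece of family B is empty. [folklore] -/
theorem squarePieceFlat_eq_nil_of_le {k β : ℕ} (hβ : 0 < β) (D : List DrawnEdge)
    (c : GridPoint × GridPoint → List Bool) {i : ℕ} (hi : squareTotal β D ≤ i) : squarePieceFlat k β D c i = [] := by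
  rw [squarePieceFlat_eq, squarePieceAt, List.getElem?_eq_none]
  rw [idxBE, Nat.le_div_iff_mul_le (Nat.mul_pos hβ (by norm_num))]
  exact hi

/-- `scaledTotal ≤ genPoly |ctx|` and `squareTotal ≤ genPoly |ctx|`. [folklore] -/
theorem totals_le (P : List GridPoint) (D : List DrawnEdge) (s t Λ k β : ℕ) (v : GridPoint) :
    scaledTotal k Λ D ≤ genPoly.eval (ctx (encodingDrawnGraphInstance.encode (P, D, s, t)) Λ k β v).length ∧
      squareTotal β D ≤ genPoly.eval (ctx (encodingDrawnGraphInstance.encode (P, D, s, t)) Λ k β v).length := by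
  set n := (ctx (encodingDrawnGraphInstance.encode (P, D, s, t)) Λ k β v).length with hn
  obtain ⟨hw, hΛ, hk, hβ, -⟩ := le_length_ctx Λ k β v (encodingDrawnGraphInstance.encode (P, D, s, t))
  have hD : D.length ≤ n := by
    refine le_trans ?_ hw
    rw [encDG_eq, length_boolPair, length_boolPair, length_boolPair]; simp [ones]; omega
  rw [genPoly_eval, scaledTotal, squareTotal]
  have hn2 : 2 ≤ n := by rw [hn, ctx, length_boolPair]; omega
  have h3 : (n + 1) * ((n + 1) * (n + 1)) ≤ 336 * (n + 1) ^ 4 := by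
    calc (n + 1) * ((n + 1) * (n + 1)) = (n + 1) ^ 3 := by ring
      _ ≤ (n + 1) ^ 4 := Nat.pow_le_pow_right (by omega) (by norm_num)
      _ ≤ 336 * (n + 1) ^ 4 := Nat.le_mul_of_pos_left _ (by norm_num)
  constructor
  · calc D.length * (Λ * k) ≤ n * (n * n) := by gcongr
      _ ≤ (n + 1) * ((n + 1) * (n + 1)) := by gcongr <;> omega
      _ ≤ 336 * (n + 1) ^ 4 := h3
  · calc D.length * (β * 3) ≤ n * (n * 3) := by gcongr
      _ ≤ (n + 1) * ((n + 1) * (n + 1)) := by gcongr <;> omega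
      _ ≤ 336 * (n + 1) ^ 4 := h3

/-- **The generator of family A computes the family-A concatenation.** For a valid drawing, with
the context of its canonical code, `Λ = maxEdges D`, `0 < k` and the translation `v`:
`genAFn ctx = ccat (scaledPieceFlat k Λ D (cV v)) (scaledTotal k Λ D)` — the framed items of
the code of the translated scaled paths (`framesOf_drawnEdges_scaleDrawing`).
[cite: LiskiewiczOgiharaToda2003, §4 (proof of Theorem 7: R₁(x) = (E₃, τ))] -/
theorem genAFn_ctx {P : List GridPoint} {D : List DrawnEdge} (hD : IsGridDrawing P D) (s t : ℕ) {k : ℕ}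
    (hk : 0 < k) (β : ℕ) (v : GridPoint) :
    genAFn (ctx (encodingDrawnGraphInstance.encode (P, D, s, t)) (maxEdges D) k β v) =
      ccat (scaledPieceFlat k (maxEdges D) D (cV v)) (scaledTotal k (maxEdges D) D) := by
  have hΛ : 1 ≤ maxEdges D := one_le_maxEdges D
  rw [genAFn, Function.comp_apply, Function.comp_apply, genInitF_apply, foldLoop_apply _ _ le_rfl, sndPow]
  simp only [Function.comp_apply, sndPow, sndF_boolPair]
  rw [foldAcc_clipF (fun j _ _ => ?_), foldAcc_appF, List.nil_append]
  · symm
    rw [← ccat_eq_ccat_of_le (totals_le P D s t (maxEdges D) k β v).1 (fun i hi => ?_)]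
    · exact ccat_congr fun i _ => by rw [Nat.zero_add]; exact (pieceAFn_argOf P D s t (maxEdges D) k β v i).symm
    · exact scaledPieceFlat_eq_nil_of_le hΛ hk D _ hi
  · exact length_pieceAFn_argOf_le P s t v hD hk j

/-- **The generator of family B computes the family-B concatenation**: for a valid drawing and
`0 < β`, `genBFn ctx = ccat (squarePieceFlat k β D (cV v)) (squareTotal β D)` — the framed
items of the code of the translated squares (`framesOf_squareEdges_sqSites`).
[cite: LiskiewiczOgiharaToda2003, §4 (proof of Theorem 7: R₁(x) = (E₃, τ))] -/
theorem genBFn_ctx {P : List GridPoint} {D : List DrawnEdge} (hD : IsGridDrawing P D) (s t Λ k : ℕ) {β : ℕ}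
    (hβ : 0 < β) (v : GridPoint) :
    genBFn (ctx (encodingDrawnGraphInstance.encode (P, D, s, t)) Λ k β v) =
      ccat (squarePieceFlat k β D (cV v)) (squareTotal β D) := by
  rw [genBFn, Function.comp_apply, Function.comp_apply, genInitF_apply, foldLoop_apply _ _ le_rfl, sndPow]
  simp only [Function.comp_apply, sndPow, sndF_boolPair]
  rw [foldAcc_clipF (fun j _ _ => ?_), foldAcc_appF, List.nil_append]
  · symm
    rw [← ccat_eq_ccat_of_le (totals_le P D s t Λ k β v).2 (fun i hi => ?_)]
    · exact ccat_congr fun i _ => by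
        rw [Nat.zero_add]; exact (pieceBFn_argOf P (two_le_length_of_mem hD) s t Λ k β v i).symm
    · exact squarePieceFlat_eq_nil_of_le hβ D _ hi
  · exact length_pieceBFn_argOf_le P s t v hD hβ j

end SqGen

end Literature.Barriers.CriticalPhenomena.GridSAW
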